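import Literature.AlgebraicGeometry.Limits.LocalizationIsoSpreadCompat
import Literature.AlgebraicGeometry.Limits.SeparatedSchematicExt
import Literature.AlgebraicGeometry.Limits.SubalgebraDiagram
import Literature.NumberTheory.EllipticCurves.NeronModelExistenceProofs
import Mathlib.AlgebraicGeometry.Morphisms.Flat
import HarnessLib

/-!
# Limits of schemes: restricting morphisms over a stage `Spec A[1/s]` to a finer stage, and the
# injectivity of restriction to the generic fibre (EGA IV₃ 8.8.2, 11.10.5)

Topic: `Literature/AlgebraicGeometry/Limits`; complement to `Limits/LocalizationIsoSpread(Compat)`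
(`overStage`, `resStage`, `exists_iso_whiskerLeft_leg_comp_eq`) and `Limits/SeparatedSchematicExt`.
Written by the prover seat `hodge-nonav-prover-Bx` (g19, cell `hodge-nonav`) as plumbing for the
equivariant spreading out of programme «M1» (`Limits/SmoothProjectiveSpreadEquivariant`); route-agnostic.

For `A`-schemes `P₁, P₂`, a morphism `φ : P₁ ⊗ Spec A[1/s] → P₂ ⊗ Spec A[1/s]` OVER `Spec A[1/s]` and a
finer stage `t ≤ s` (`s ∣ t`):

* `res h φ : P₁ ⊗ Spec A[1/t] → P₂ ⊗ Spec A[1/t]` — the base change of `φ` to the finer stage, written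
  with the cartesian-monoidal structure of `Over (Spec A)` (`overStage (resStage h (φ ≫ fst))`); it is
  characterised by `res h φ ≫ (P₂ ◁ ι) = (P₁ ◁ ι) ≫ φ` for the monomorphism `ι : Spec A[1/t] → Spec A[1/s]`
  (`res_comp_whiskerLeft`), hence functorial (`res_id`, `res_comp`, `resIso`), compatible with
  `w ▷ -` (`res_whiskerRight`) and with the values at the limit `Spec B = Spec A_S`
  (`whiskerLeft_leg_comp_res`);
* `isSchemeTheoreticallyDominant_whiskerLeft_left` — `(P ◁ g).left`, the base change of `g.left` along
  `P ⊗ T → T` (`SubalgApprox.isPullback_whiskerLeft_left`), is scheme-theoretically dominant when `g.left`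
  is (and quasi-compact) and `P ⊗ T → T` is flat (EGA IV₃ 11.10.5);
* `ext_of_whiskerLeft_comp_eq` ∕ `ext_of_whiskerLeft_leg_comp_eq` — two morphisms
  `P ⊗ T → N ⊗ T` over `T`, with `P ⊗ T → T` flat and `N ⊗ T → T` separated, which agree after
  `P ◁ g` for such a `g` (e.g. the leg `Spec K → Spec A[1/t]`, `K = Frac A`) are EQUAL
  (`ext_of_isSchemeTheoreticallyDominant_of_isSeparated`, EGA IV₃ 11.10.1).

Honest scope: general scheme theory; nothing here bears on any conjecture.

## References

* A. Grothendieck, J. Dieudonné, EGA IV₃ (1966), Thm. 8.8.2, 11.10.1, 11.10.5. [EGAIV3]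
* U. Görtz, T. Wedhorn, *Algebraic Geometry I*, 2nd ed. (2020), Thm. 10.63, Cor. 10.64,
  Prop. 9.19, Rem. 9.20. [GortzWedhorn2020]
* The Stacks project, Tag 01ZC. [StacksProject]
-/

noncomputable section

universe u

open CategoryTheory CategoryTheory.Limits AlgebraicGeometry MonoidalCategory CartesianMonoidalCategory

namespace Literature.AlgebraicGeometry.Limits

namespace LocApprox

open Literature.AlgebraicGeometry.Motives (SchemeOver specOver)

set_option backward.isDefEq.respectTransparency false

/-! ## `(P ◁ g).left` is scheme-theoretically dominant under flatness -/

section WhiskerLeft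

variable {A : Type u} [CommRing A] (P : SchemeOver A) {T' T : SchemeOver A} (g : T' ⟶ T)

/-- `(P ◁ g).left : (P ⊗ T').left → (P ⊗ T).left` — the base change of `g.left` along `P ⊗ T → T`
(`SubalgApprox.isPullback_whiskerLeft_left`) — is scheme-theoretically dominant when `g.left` is
quasi-compact and scheme-theoretically dominant and `P ⊗ T → T` is flat (EGA IV₃ 11.10.5, Mathlib
`IsSchemeTheoreticallyDominant.of_isPullback`). [cite: EGAIV3, 11.10.5] -/
theorem isSchemeTheoreticallyDominant_whiskerLeft_left [IsSchemeTheoreticallyDominant g.left]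
    [QuasiCompact g.left] [Flat (pullback.snd P.hom T.hom)] :
    IsSchemeTheoreticallyDominant (P ◁ g).left :=
  IsSchemeTheoreticallyDominant.of_isPullback (SubalgApprox.isPullback_whiskerLeft_left P g).flip

/-- **Two morphisms `P ⊗ T → N ⊗ T` over `T` which agree after `P ◁ g` are equal**, for `g.left`
quasi-compact and scheme-theoretically dominant, `P ⊗ T → T` flat and `N ⊗ T → T` separated
(EGA IV₃ 11.10.1: morphisms to a separated scheme agreeing on a scheme-theoretically dense subscheme
coincide). [cite: EGAIV3, 11.10.5 and 11.10.1] [cite: GortzWedhorn2020, Prop. 9.19 and Rem. 9.20] -/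
theorem ext_of_whiskerLeft_comp_eq {N : SchemeOver A} (a b : P ⊗ T ⟶ N ⊗ T)
    (ha : a ≫ snd N T = snd P T) (hb : b ≫ snd N T = snd P T)
    [IsSchemeTheoreticallyDominant g.left] [QuasiCompact g.left] [Flat (pullback.snd P.hom T.hom)]
    [IsSeparated (pullback.snd N.hom T.hom)] (h : (P ◁ g) ≫ a = (P ◁ g) ≫ b) : a = b := by
  haveI := isSchemeTheoreticallyDominant_whiskerLeft_left P g
  have ha' : a.left ≫ pullback.snd N.hom T.hom = pullback.snd P.hom T.hom :=
    congrArg CommaMorphism.left ha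
  have hb' : b.left ≫ pullback.snd N.hom T.hom = pullback.snd P.hom T.hom :=
    congrArg CommaMorphism.left hb
  exact Over.OverMorphism.ext
    (ext_of_isSchemeTheoreticallyDominant_of_isSeparated (pullback.snd N.hom T.hom)
      (ha'.trans hb'.symm) (P ◁ g).left (congrArg CommaMorphism.left h))

end WhiskerLeft

/-! ## Restriction of morphisms over a stage to a finer stage -/

section Res

variable {A : Type u} [CommRing A] {S : Submonoid A}
variable {P₁ P₂ P₃ : SchemeOver A} {t s : Idx S} (h : t ⟶ s)

/-- **Restriction to a finer stage.** For `φ : P₁ ⊗ Spec A[1/s] → P₂ ⊗ Spec A[1/s]` (meant to be over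
`Spec A[1/s]`) and `t ≤ s`, the morphism `P₁ ⊗ Spec A[1/t] → P₂ ⊗ Spec A[1/t]` over `Spec A[1/t]`
obtained by base change (`overStage ∘ resStage` of `φ ≫ fst`). [cite: GortzWedhorn2020, Thm. 10.63] -/
def res (φ : P₁ ⊗ (baseDiagram S).obj s ⟶ P₂ ⊗ (baseDiagram S).obj s) :
    P₁ ⊗ (baseDiagram S).obj t ⟶ P₂ ⊗ (baseDiagram S).obj t :=
  overStage (resStage h (φ ≫ fst _ _))

/-- `res h φ` is over `Spec A[1/t]`. [cite: GortzWedhorn2020, Thm. 10.63] -/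
@[reassoc (attr := simp)]
theorem res_snd (φ : P₁ ⊗ (baseDiagram S).obj s ⟶ P₂ ⊗ (baseDiagram S).obj s) :
    res h φ ≫ snd _ _ = snd _ _ :=
  overStage_snd _

/-- A morphism over the stage is `overStage` of its first component. [cite: GortzWedhorn2020, Thm. 10.63] -/
theorem overStage_comp_fst (φ : P₁ ⊗ (baseDiagram S).obj s ⟶ P₂ ⊗ (baseDiagram S).obj s)
    (hφ : φ ≫ snd _ _ = snd _ _) : overStage (φ ≫ fst _ _) = φ := by
  apply CartesianMonoidalCategory.hom_ext
  · rw [overStage_fst]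
  · rw [overStage_snd, hφ]

/-- **The defining square of `res`**: `res h φ ≫ (P₂ ◁ ι) = (P₁ ◁ ι) ≫ φ` for the transition map
`ι : Spec A[1/t] → Spec A[1/s]` (for `φ` over `Spec A[1/s]`). [cite: GortzWedhorn2020, Thm. 10.63] -/
@[reassoc]
theorem res_comp_whiskerLeft (φ : P₁ ⊗ (baseDiagram S).obj s ⟶ P₂ ⊗ (baseDiagram S).obj s)
    (hφ : φ ≫ snd _ _ = snd _ _) :
    res h φ ≫ (P₂ ◁ (baseDiagram S).map h) = (P₁ ◁ (baseDiagram S).map h) ≫ φ := by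
  rw [res, overStage_resStage_whiskerLeft, overStage_comp_fst φ hφ]

/-- `res` of the identity. [cite: GortzWedhorn2020, Thm. 10.63] -/
theorem res_id : res h (𝟙 (P₁ ⊗ (baseDiagram S).obj s)) = 𝟙 _ := by
  rw [← cancel_mono (P₁ ◁ (baseDiagram S).map h), res_comp_whiskerLeft h _ (Category.id_comp _),
    Category.id_comp, Category.comp_id]

/-- `res` of a composite (functoriality of base change to a finer stage). [cite: GortzWedhorn2020, Thm. 10.63] -/
theorem res_comp (φ : P₁ ⊗ (baseDiagram S).obj s ⟶ P₂ ⊗ (baseDiagram S).obj s)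
    (ψ : P₂ ⊗ (baseDiagram S).obj s ⟶ P₃ ⊗ (baseDiagram S).obj s)
    (hφ : φ ≫ snd _ _ = snd _ _) (hψ : ψ ≫ snd _ _ = snd _ _) :
    res h (φ ≫ ψ) = res h φ ≫ res h ψ := by
  rw [← cancel_mono (P₃ ◁ (baseDiagram S).map h),
    res_comp_whiskerLeft h _ (by rw [Category.assoc, hψ, hφ]), Category.assoc,
    res_comp_whiskerLeft h _ hψ, res_comp_whiskerLeft_assoc h _ hφ]

/-- `res` of `w ▷ Spec A[1/s]` is `w ▷ Spec A[1/t]`. [cite: GortzWedhorn2020, Thm. 10.63] -/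
theorem res_whiskerRight (w : P₁ ⟶ P₂) :
    res h (w ▷ (baseDiagram S).obj s) = w ▷ (baseDiagram S).obj t := by
  rw [← cancel_mono (P₂ ◁ (baseDiagram S).map h), res_comp_whiskerLeft h _ (whiskerRight_snd _ _),
    whisker_exchange]

/-- **Restriction of isomorphisms over a stage.** [cite: GortzWedhorn2020, Cor. 10.64] -/
def resIso (e : P₁ ⊗ (baseDiagram S).obj s ≅ P₂ ⊗ (baseDiagram S).obj s)
    (he : e.hom ≫ snd _ _ = snd _ _) : P₁ ⊗ (baseDiagram S).obj t ≅ P₂ ⊗ (baseDiagram S).obj t where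
  hom := res h e.hom
  inv := res h e.inv
  hom_inv_id := by
    rw [← res_comp h _ _ he (by rw [Iso.inv_comp_eq, he]), Iso.hom_inv_id, res_id]
  inv_hom_id := by
    rw [← res_comp h _ _ (by rw [Iso.inv_comp_eq, he]) he, Iso.inv_hom_id, res_id]

/-- The `hom` of `resIso` (by `rfl`). [cite: GortzWedhorn2020, Cor. 10.64] -/
@[simp]
theorem resIso_hom (e : P₁ ⊗ (baseDiagram S).obj s ≅ P₂ ⊗ (baseDiagram S).obj s)
    (he : e.hom ≫ snd _ _ = snd _ _) : (resIso h e he).hom = res h e.hom := rfl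

/-- The `inv` of `resIso` (by `rfl`). [cite: GortzWedhorn2020, Cor. 10.64] -/
@[simp]
theorem resIso_inv (e : P₁ ⊗ (baseDiagram S).obj s ≅ P₂ ⊗ (baseDiagram S).obj s)
    (he : e.hom ≫ snd _ _ = snd _ _) : (resIso h e he).inv = res h e.inv := rfl

variable (B : Type u) [CommRing B] [Algebra A B] [IsLocalization S B]

/-- **Values at the limit are unchanged by restriction**: if `(P₁ ◁ π_s) ≫ φ = θ ≫ (P₂ ◁ π_s)` for the
legs `π` of `Spec B = lim Spec A[1/s]`, then `(P₁ ◁ π_t) ≫ res h φ = θ ≫ (P₂ ◁ π_t)`.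
[cite: GortzWedhorn2020, Cor. 10.64 (2), p. 329] -/
@[reassoc]
theorem whiskerLeft_leg_comp_res (φ : P₁ ⊗ (baseDiagram S).obj s ⟶ P₂ ⊗ (baseDiagram S).obj s)
    (hφ : φ ≫ snd _ _ = snd _ _) (θ : P₁ ⊗ specOver A B ⟶ P₂ ⊗ specOver A B)
    (hc : (P₁ ◁ leg S B s) ≫ φ = θ ≫ (P₂ ◁ leg S B s)) :
    (P₁ ◁ leg S B t) ≫ res h φ = θ ≫ (P₂ ◁ leg S B t) := by
  rw [← cancel_mono (P₂ ◁ (baseDiagram S).map h), Category.assoc, res_comp_whiskerLeft h _ hφ,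
    ← MonoidalCategory.whiskerLeft_comp_assoc, leg_comp_map, hc, Category.assoc,
    ← MonoidalCategory.whiskerLeft_comp, leg_comp_map]

end Res

/-! ## Morphisms over a stage are determined by their generic value (`A` a domain, `K = Frac A`) -/

section Generic

variable {A : Type u} [CommRing A] [IsDomain A] (K : Type u) [Field K] [Algebra A K] [IsFractionRing A K]

/-- **Two morphisms `P ⊗ Spec A[1/t] → N ⊗ Spec A[1/t]` over `Spec A[1/t]`, with `P ⊗ Spec A[1/t]` flat
and `N ⊗ Spec A[1/t]` separated over `Spec A[1/t]`, which agree on the generic fibre `P ⊗ Spec K` are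
equal** (the leg `Spec K → Spec A[1/t]` is scheme-theoretically dominant,
`isSchemeTheoreticallyDominant_leg_left`; EGA IV₃ 11.10.5, 11.10.1).
[cite: EGAIV3, 11.10.5 and 11.10.1] [cite: GortzWedhorn2020, Rem. 9.20] -/
theorem ext_of_whiskerLeft_leg_comp_eq {P N : SchemeOver A} {t : Idx (nonZeroDivisors A)}
    (a b : P ⊗ (baseDiagram (nonZeroDivisors A)).obj t ⟶ N ⊗ (baseDiagram (nonZeroDivisors A)).obj t)
    (ha : a ≫ snd _ _ = snd _ _) (hb : b ≫ snd _ _ = snd _ _)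
    [Flat (pullback.snd P.hom ((baseDiagram (nonZeroDivisors A)).obj t).hom)]
    [IsSeparated (pullback.snd N.hom ((baseDiagram (nonZeroDivisors A)).obj t).hom)]
    (h : (P ◁ leg (nonZeroDivisors A) K t) ≫ a = (P ◁ leg (nonZeroDivisors A) K t) ≫ b) : a = b := by
  haveI : IsSchemeTheoreticallyDominant (leg (nonZeroDivisors A) K t).left :=
    Literature.NumberTheory.EllipticCurves.isSchemeTheoreticallyDominant_leg_left K t
  exact ext_of_whiskerLeft_comp_eq P (leg (nonZeroDivisors A) K t) a b ha hb h

end Generic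

end LocApprox

end Literature.AlgebraicGeometry.Limits

end
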